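import Summits.Ventures.AbcShadow.SH04.Row47_13

/-!
# Venture AbcShadow — ROW SH-04 `(47, 13)` v2: the sieve for ALL 31 orbits in kernel (no computed exclusion)

HONEST FRAMING. Successor file (same session, typer seat `abc-shadow-typ-1` g2) of `SH04/Row47_13.lean`: there the orbit `1269.13`
had no kernel tree because the certificate of record prints `θ`-data only for `q ≤ 37` while the orbit's last prime above 13
dies at `q = 53`; the row therefore carried ONE computed exclusion `hX`. The cell's engine seat eng-2 g2 supplied the missing
datum `c₅₃(θ)` (micro-job μ0 = kit j318576, file `pub/abc-shadow/eng-2g2-j318576/mu0-mu3supp.txt`, sha16 388e4c103ed2afd6, with an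
identification guard against certificate 4a36c28685fe0350 part C), `SH04/Level1269.lean` gained (append-only) `orbit_1269_13x`,
a mod-13 tree on `q ∈ {5, 53}` checked by `decide +kernel`, and the v2 list `level1269OrbitsV2` with `level1269V2_elim13`
(ALL 14 orbits eliminated). THIS FILE: `sh04_47_13_core_gen` (the v1 core with the three orbit lists as parameters) and
`sh04_47_13_v2 : … → SH04Pair47_13` whose hypotheses are EXACTLY `hP : M.BVY04Package` (CITED), `DataComplete 141/423/1269`
(COMPUTED; at 1269 for the v2 list) and `hDM : darmonMerel1997_sumOfPowersEqCube` (CITED, only for `13 ∣ α`) — the computed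
exclusion `hX` is GONE: the [BVY04, Prop 4.2] sieve at `n = 13` is discharged in the kernel for all `6 + 11 + 14 = 31` orbits.
`sh04_47_13_v2_of_not_dvd` is the `13 ∤ α` part without [DM97]. A CONDITIONAL typed/kernel-checked REDUCTION; the newform data is
COMPUTED (certificate 4a36c28685fe0350 + datum 388e4c103ed2afd6) and enters as `DataComplete`; print inputs are NAMED hypotheses;
adjacent (signature (n,n,3)), NOT abc; no side on IUT. AI-typed; weaker than expert refereeing of the cited inputs.
-/

namespace Summit.Ventures.AbcShadow

open Summit.Ventures.AbcSig (NewformModel FreyDatum OrbitData)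
open Literature.NumberTheory.DiophantineGeometry (darmonMerel1997_sumOfPowersEqCube)

/-- **Core of the row, generalised in the level lists** (normal form; the proof of `sh04_47_13_core` of `Row47_13.lean` with
the three orbit lists, their wellformedness and their kernel-elimination facts as parameters instead of the v1 lists + `hX`):
under the named hypotheses there is no datum `A a¹³ + B b¹³ = c³` with `A·B = 47^e`, `1 ≤ e ≤ 12`, `Aa, Bb, c` pairwise coprime
and nonzero, in print's normal form `3 ∤ Aa`, `Bb¹³ ≢ 2 (mod 3)`, with `ab ≠ ±1`. CASE TREE: [L.3.4 + Cor 3.3] give a newform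
`f` of level `141` (`3 ∣ b`), `423` (`9 ∣ 2 + Bb¹³ − 3c`) or `1269` (`3 ∥ 2 + Bb¹³ − 3c`) with the [Prop 4.2] congruences at the
exponent 13; `DataComplete` puts `f` in one of the listed orbits; every listed orbit is killed by its elimination hypothesis.
[cite: BennettVatsalYazdani2004, Lemma 3.4 p.1406, Cor 3.3 p.1405, Prop 4.2 pp.1406-1407] -/
theorem sh04_47_13_core_gen (M : CMNewformModel) (hP : M.BVY04Package) (L141 L423 L1269 : List OrbitData)
    (hw141 : ∀ o ∈ L141, ∀ e ∈ o.coeffs, e.ell.Prime ∧ e.ell ≠ 2 ∧ ¬ e.ell ∣ 141)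
    (hw423 : ∀ o ∈ L423, ∀ e ∈ o.coeffs, e.ell.Prime ∧ e.ell ≠ 2 ∧ ¬ e.ell ∣ 423)
    (hw1269 : ∀ o ∈ L1269, ∀ e ∈ o.coeffs, e.ell.Prime ∧ e.ell ≠ 2 ∧ ¬ e.ell ∣ 1269)
    (he141 : ∀ o ∈ L141, o.Eliminated bvy04AllowedPrint 13) (he423 : ∀ o ∈ L423, o.Eliminated bvy04AllowedPrint 13)
    (he1269 : ∀ o ∈ L1269, o.Eliminated bvy04AllowedPrint 13)
    (hD141 : M.DataComplete 141 L141) (hD423 : M.DataComplete 423 L423) (hD1269 : M.DataComplete 1269 L1269)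
    {A B e : ℕ} (he1 : 1 ≤ e) (he12 : e ≤ 12) (hAB : A * B = 47 ^ e) {a b c : ℤ}
    (hsol : IsPrimitiveSolution A B 1 13 a b c) (h3a : ¬ (3 : ℤ) ∣ (A : ℤ) * a)
    (h3b : ¬ (3 : ℤ) ∣ (B : ℤ) * b ^ 13 - 2) (hab1 : a * b ≠ 1) (hab2 : a * b ≠ -1) : False := by
  -- arithmetic of the coefficients
  have h47e : 0 < 47 ^ e := Nat.pow_pos (by norm_num)
  have hA0 : 0 < A := Nat.pos_of_ne_zero (fun h => by rw [h, zero_mul] at hAB; omega)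
  have hB0 : 0 < B := Nat.pos_of_ne_zero (fun h => by rw [h, mul_zero] at hAB; omega)
  have hAdvd : A ∣ 47 ^ e := Dvd.intro _ hAB
  have hBdvd : B ∣ 47 ^ e := Dvd.intro_left _ hAB
  have p47 : Nat.Prime 47 := by norm_num
  have p13 : Nat.Prime 13 := by norm_num
  have hfree : ∀ D : ℕ, D ∣ 47 ^ e → ∀ q : ℕ, q.Prime → ¬ q ^ 13 ∣ D := by
    intro D hD q hq h
    have hq47 : q ∣ 47 ^ e := (dvd_pow_self q (by norm_num)).trans (h.trans hD)
    have hq : q = 47 := (Nat.prime_dvd_prime_iff_eq hq p47).mp (hq.dvd_of_dvd_pow hq47)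
    subst hq
    have := (Nat.pow_dvd_pow_iff_le_right (by norm_num : 1 < 47)).mp (h.trans hD)
    omega
  have hcube : ∀ q : ℕ, q.Prime → ¬ q ^ 3 ∣ 1 := by
    intro q hq h
    have : q ^ 3 = 1 := Nat.dvd_one.mp h
    rcases pow_eq_one_iff.mp this with h1 | h0
    · exact hq.one_lt.ne' h1
    · exact absurd h0 (by norm_num)
  have h13 : ¬ 13 ∣ A * B * 1 := by
    rw [mul_one, hAB]
    intro h
    have := (Nat.prime_dvd_prime_iff_eq p13 p47).mp (p13.dvd_of_dvd_pow h)
    omega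
  have h3B : ¬ (3 : ℤ) ∣ (B : ℤ) := by
    intro h
    have h' : 3 ∣ B := by exact_mod_cast h
    have := (Nat.prime_dvd_prime_iff_eq Nat.prime_three p47).mp (Nat.prime_three.dvd_of_dvd_pow (h'.trans hBdvd))
    omega
  obtain ⟨hL141, hL423, hL1269⟩ := bvy04Level_47 A B e (by omega) hAB
  -- the package at a row `κ` of level `N ∈ {141, 423, 1269}` yields a contradiction with the kernel sieve
  let S : FreyDatum := ⟨A, B, 1, 13, a, b, c⟩
  have key : ∀ (κ : BVYCase) (N : ℕ), κ.Holds A B 1 13 a b c → bvy04Level κ A B 1 = N →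
      (N = 141 ∨ N = 423 ∨ N = 1269) → False := by
    intro κ N hκ hN hN3
    have hpk := hP S κ hA0 hB0 Nat.one_pos hcube (fun q hq => ⟨hfree A hAdvd q hq, hfree B hBdvd q hq⟩)
      p13 (by norm_num) h13 h3a h3b hsol hab1 hab2
      (by norm_num) (by norm_num) hκ N hN
    obtain ⟨⟨f, hf⟩, hmod⟩ := hpk
    have hmodf : M.ArisesMod f 13 bvy04AllowedPrint := hmod f hf
    rcases hN3 with rfl | rfl | rfl
    · obtain ⟨o, ho, hfo⟩ := hD141 f
      exact M.not_arisesMod_of_eliminated f o hfo 13 bvy04AllowedPrint (he141 o ho) (hw141 o ho) hmodf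
    · obtain ⟨o, ho, hfo⟩ := hD423 f
      exact M.not_arisesMod_of_eliminated f o hfo 13 bvy04AllowedPrint (he423 o ho) (hw423 o ho) hmodf
    · obtain ⟨o, ho, hfo⟩ := hD1269 f
      exact M.not_arisesMod_of_eliminated f o hfo 13 bvy04AllowedPrint (he1269 o ho) (hw1269 o ho) hmodf
  -- the case tree of [Cor 3.3]
  by_cases h3 : (3 : ℤ) ∣ (B : ℤ) * b
  · -- `3 ∣ b`: row `ε′₃ = 3`, level 141
    have h3b' : (3 : ℤ) ∣ b := by
      rcases Int.prime_three.dvd_or_dvd h3 with h | h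
      · exact absurd h h3B
      · exact h
    refine key .bLarge 141 ⟨?_, ?_⟩ hL141 (Or.inl rfl)
    · exact Dvd.dvd.mul_left ((pow_dvd_pow (3 : ℤ) (by norm_num : 4 ≤ 13)).trans (pow_dvd_pow_of_dvd h3b' 13)) _
    · rintro ⟨h27, -⟩
      exact h3B ((dvd_pow_self 3 (by norm_num)).trans h27)
  · have h3bn : ¬ (3 : ℤ) ∣ (B : ℤ) * b ^ 13 := by
      intro h
      rcases Int.prime_three.dvd_or_dvd h with h' | h'
      · exact h3B h'
      · exact h3 (Dvd.dvd.mul_left (Int.Prime.dvd_pow' (by norm_num) h') _)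
    have hdiv : (3 : ℤ) ∣ 2 + (B : ℤ) * b ^ 13 - 3 * c := by
      omega
    by_cases h9 : (9 : ℤ) ∣ 2 + (B : ℤ) * b ^ 13 - 3 * c
    · -- row `ε′₃ = 3²`, level 423
      refine key .nine 423 ?_ hL423 (Or.inr (Or.inl rfl))
      simpa [BVYCase.Holds] using h9
    · -- row `ε′₃ = 3³`, level 1269
      refine key .three 1269 ?_ hL1269 (Or.inr (Or.inr rfl))
      refine ⟨by simpa using hdiv, ?_⟩
      simpa using h9


/-! ## The row, v2 -/

/-- **Row SH-04 `(47, 13)` for `13 ∤ α`, v2 (no Darmon–Merel input, NO computed exclusion).** Under the named hypotheses (v2 list at 1269),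
`x¹³ + 47^α y¹³ = z³` has no solution in pairwise coprime integers with `|xy| > 1` when `13 ∤ α`. Kernel steps: `47 ∤ xz`,
reduction `α = 13k + e`, `b = 47^k y`, print's normal form via `(A,a) ↔ (B,b)` and `(a,b,c) ↦ (−a,−b,−c)`.
[cite: BennettVatsalYazdani2004, Thm 1.6 p.1400 (pair (47,13)); Lemma 3.4, Cor 3.3, Prop 4.2] -/
theorem sh04_47_13_v2_of_not_dvd (M : CMNewformModel) (hP : M.BVY04Package)
    (hD141 : M.DataComplete 141 level141Orbits) (hD423 : M.DataComplete 423 level423Orbits)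
    (hD1269 : M.DataComplete 1269 level1269OrbitsV2)
    (α : ℕ) (hα : 0 < α) (h13 : ¬ 13 ∣ α) (x y z : ℤ) (hxy : IsCoprime x y) (hxz : IsCoprime x z)
    (hyz : IsCoprime y z) (hbig : 1 < |x * y|) (heq : x ^ 13 + (47 : ℤ) ^ α * y ^ 13 = z ^ 3) : False := by
  obtain ⟨h47x, h47z⟩ := sh04_47_not_dvd hα hxz heq
  -- `α = 13 k + e`, `1 ≤ e ≤ 12`
  set k := α / 13 with hk
  set e := α % 13 with he
  have hαke : α = 13 * k + e := (Nat.div_add_mod α 13).symm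
  have he1 : 1 ≤ e := Nat.pos_of_ne_zero (fun h0 => h13 (Nat.dvd_of_mod_eq_zero h0))
  have he12 : e ≤ 12 := Nat.le_of_lt_succ (Nat.mod_lt α (by norm_num))
  set Y : ℤ := (47 : ℤ) ^ k * y with hY
  have hpow : (47 : ℤ) ^ α * y ^ 13 = ((47 ^ e : ℕ) : ℤ) * Y ^ 13 := by
    rw [hαke, hY]; push_cast; ring
  -- nonvanishing and coprimality
  have hx0 : x ≠ 0 := by rintro rfl; simp at hbig
  have hy0 : y ≠ 0 := by rintro rfl; simp at hbig
  have hz0 : z ≠ 0 := by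
    rintro rfl
    have hx1 := Int.isUnit_iff_abs_eq.mp (isCoprime_zero_right.mp hxz)
    have hy1 := Int.isUnit_iff_abs_eq.mp (isCoprime_zero_right.mp hyz)
    rw [abs_mul, hx1, hy1] at hbig
    norm_num at hbig
  have p47 : Prime (47 : ℤ) := Int.prime_iff_natAbs_prime.mpr (by norm_num)
  have hc47x : IsCoprime (47 : ℤ) x := p47.irreducible.coprime_iff_not_dvd.mpr h47x
  have hc47z : IsCoprime (47 : ℤ) z := p47.irreducible.coprime_iff_not_dvd.mpr h47z
  have hBY : ((47 ^ e : ℕ) : ℤ) * Y = (47 : ℤ) ^ (e + k) * y := by rw [hY]; push_cast; ring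
  have hxBY : IsCoprime x (((47 ^ e : ℕ) : ℤ) * Y) := by
    rw [hBY]
    exact (hc47x.symm.pow_right).mul_right hxy
  have hBYz : IsCoprime (((47 ^ e : ℕ) : ℤ) * Y) z := by
    rw [hBY]
    exact (hc47z.pow_left).mul_left hyz
  have hBY0 : ((47 ^ e : ℕ) : ℤ) * Y ≠ 0 := by
    rw [hBY]; exact mul_ne_zero (pow_ne_zero _ (by norm_num)) hy0
  have hxY : x * Y ≠ 1 ∧ x * Y ≠ -1 := by
    have hlt : 1 < |x * Y| := by
      rw [hY, show x * ((47 : ℤ) ^ k * y) = (47 : ℤ) ^ k * (x * y) by ring, abs_mul]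
      calc (1 : ℤ) = 1 * 1 := by norm_num
        _ < |(47 : ℤ) ^ k| * |x * y| := by
          apply mul_lt_mul' _ hbig (by norm_num) (by positivity)
          rw [abs_pow]; exact one_le_pow₀ (by norm_num)
    constructor <;> intro h <;> rw [h] at hlt <;> norm_num at hlt
  have heq' : x ^ 13 + ((47 ^ e : ℕ) : ℤ) * Y ^ 13 = z ^ 3 := by rw [← hpow]; exact heq
  have hAB1 : 1 * 47 ^ e = 47 ^ e := one_mul _
  have hAB2 : 47 ^ e * 1 = 47 ^ e := mul_one _
  -- print's normal form
  by_cases h3x : (3 : ℤ) ∣ x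
  · -- swap: `A = 47^e`, `a = Y`, `B = 1`, `b = x`
    refine sh04_47_13_core_gen M hP level141Orbits level423Orbits level1269OrbitsV2 level141_wellformed
          level423_wellformed level1269V2_wellformed level141_elim13 level423_elim13 level1269V2_elim13 hD141 hD423 hD1269 he1 he12 hAB2 (a := Y) (b := x) (c := z)
      ⟨by rw [← heq']; push_cast; ring, hBY0, by simpa using hx0, by simpa using hz0, by simpa using hxBY.symm,
        by simpa using hBYz, by simpa using hxz⟩ ?_ ?_ (by rw [mul_comm]; exact hxY.1) (by rw [mul_comm]; exact hxY.2)
    · intro h3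
      have hu : IsUnit (3 : ℤ) := hxBY.isUnit_of_dvd' h3x h3
      rcases Int.isUnit_iff.mp hu with h | h <;> norm_num at h
    · have : (3 : ℤ) ∣ x ^ 13 := dvd_pow h3x (by norm_num)
      push_cast
      omega
  · by_cases h3b : (3 : ℤ) ∣ ((47 ^ e : ℕ) : ℤ) * Y ^ 13 - 2
    · -- sign change: `(a, b, c) = (−x, −Y, −z)`
      refine sh04_47_13_core_gen M hP level141Orbits level423Orbits level1269OrbitsV2 level141_wellformed
          level423_wellformed level1269V2_wellformed level141_elim13 level423_elim13 level1269V2_elim13 hD141 hD423 hD1269 he1 he12 hAB1 (a := -x) (b := -Y) (c := -z)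
        ⟨?_, by simpa using hx0, by simpa using hBY0, by simpa using hz0, by simpa using hxBY.neg_neg,
          by simpa using hxz.neg_neg, by simpa using hBYz.neg_neg⟩ (by simpa using h3x) ?_
        (by rw [neg_mul_neg]; exact hxY.1) (by rw [neg_mul_neg]; exact hxY.2)
      · have h1 : (-x) ^ 13 = -(x ^ 13) := Odd.neg_pow (by decide) x
        have h2 : (-Y) ^ 13 = -(Y ^ 13) := Odd.neg_pow (by decide) Y
        have h3 : (-z) ^ 3 = -(z ^ 3) := Odd.neg_pow (by decide) z
        rw [Nat.cast_one, one_mul, one_mul, h1, h2, h3, ← heq']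
        ring
      · have h2 : (-Y) ^ 13 = -(Y ^ 13) := Odd.neg_pow (by decide) Y
        rw [h2, mul_neg]
        omega
    · -- already normal: `(a, b, c) = (x, Y, z)`
      exact sh04_47_13_core_gen M hP level141Orbits level423Orbits level1269OrbitsV2 level141_wellformed
          level423_wellformed level1269V2_wellformed level141_elim13 level423_elim13 level1269V2_elim13 hD141 hD423 hD1269 he1 he12 hAB1 (a := x) (b := Y) (c := z)
        ⟨by rw [← heq']; push_cast; ring, by simpa using hx0, hBY0, by simpa using hz0, by simpa using hxBY,
          by simpa using hxz, by simpa using hBYz⟩ (by simpa using h3x) h3b hxY.1 hxY.2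

/-- **Row SH-04 `(47, 13)` (reduction theorem, v2 = 31/31 orbits in kernel).** Under the named hypotheses (module docstring) —
the cited [BVY04] print package, the COMPUTED newform data of levels `141, 423, 1269` (`DataComplete`, v2 list at 1269), and
[DM97] for the sub-case `13 ∣ α` — the equation `x¹³ + 47^α y¹³ = z³` has no solution in pairwise
coprime integers with `|xy| > 1` for any `α ≥ 1`: the printed possibly-exceptional pair `(47, 13)` of [BVY04, Thm 1.6]
does not occur, i.e. `SH04Pair47_13`. ADJACENT, NOT abc.
[cite: BennettVatsalYazdani2004, Thm 1.6 p.1400 (pair (47,13), conditionally on the named inputs)] -/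
theorem sh04_47_13_v2 (M : CMNewformModel) (hP : M.BVY04Package)
    (hD141 : M.DataComplete 141 level141Orbits) (hD423 : M.DataComplete 423 level423Orbits)
    (hD1269 : M.DataComplete 1269 level1269OrbitsV2)
    (hDM : darmonMerel1997_sumOfPowersEqCube) : SH04Pair47_13 := by
  intro α hα x y z hxy hxz hyz hbig heq
  by_cases h13 : 13 ∣ α
  · -- `α = 13 k`: `x¹³ + (47^k y)¹³ = z³`, excluded by [DM97]
    obtain ⟨k, rfl⟩ := h13
    obtain ⟨h47x, -⟩ := sh04_47_not_dvd hα hxz heq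
    have p47 : Prime (47 : ℤ) := Int.prime_iff_natAbs_prime.mpr (by norm_num)
    have hc47x : IsCoprime (47 : ℤ) x := p47.irreducible.coprime_iff_not_dvd.mpr h47x
    have hxY : IsCoprime x ((47 : ℤ) ^ k * y) := (hc47x.symm.pow_right).mul_right hxy
    have hz0 : z ≠ 0 := by
      rintro rfl
      have hx1 := Int.isUnit_iff_abs_eq.mp (isCoprime_zero_right.mp hxz)
      have hy1 := Int.isUnit_iff_abs_eq.mp (isCoprime_zero_right.mp hyz)
      rw [abs_mul, hx1, hy1] at hbig
      norm_num at hbig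
    have hbig' : 1 < |x * ((47 : ℤ) ^ k * y)| := by
      rw [show x * ((47 : ℤ) ^ k * y) = (47 : ℤ) ^ k * (x * y) by ring, abs_mul]
      calc (1 : ℤ) = 1 * 1 := by norm_num
        _ < |(47 : ℤ) ^ k| * |x * y| := by
          apply mul_lt_mul' _ hbig (by norm_num) (by positivity)
          rw [abs_pow]; exact one_le_pow₀ (by norm_num)
    refine Literature.NumberTheory.DiophantineGeometry.BennettVatsalYazdani2004.thm81_one_of_darmonMerel hDM
      (n := 13) (by norm_num) hz0 hxY hbig' ?_
    rw [one_mul, ← heq]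
    ring
  · exact sh04_47_13_v2_of_not_dvd M hP hD141 hD423 hD1269 α hα h13 x y z hxy hxz hyz hbig heq

end Summit.Ventures.AbcShadow
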